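import Summits.CriticalPhenomena.CardyFormulaZ2.Theorems.CardyIKTransportCornerLineDescentLine
import Literature.Probability.LatticeModels.CornerFugacityMeasure

/-!
# Sketch — crux idea `sparse-parity-pivot` (crux stmt-CriticalPhenomena-10964, `CornerLineDescent`)

Round-2 ideator 4.  Typed first lemma + transfer statements over the lead's landed vocabulary
(`Theorems/CardyIKTransportCornerLineDescentLine.lean`: `Bits`, `gaugeMeasure p`, `gaugeColour`,
`gaugeCrossingProb p R δ`, `bondStdCrossingProb`, `pIK`, `influence`, `cornerLineDescent_iff`).
Everything elaborates; the composition theorems are proved (no sorry); bridges are `def … : Prop`.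

THE PIVOT.  In the lead's density chart the corner line is `p ∈ [0, ½]` (`t = p/(1−p)`): `p = 0` is
bond-ℤ² on the renewal grid, `p = pIK = 2√3−3 ≈ 0.4641` the isotropic IK point, and `p = ½`
(`t = 1`, i.i.d. fair colours + fair saddle coins) is EXACTLY critical site percolation on
Beffara's centred square lattice `G_s` (Beffara 2008 §5.1, `P_{1/2,1/2}`): given the colours, "one
uniformly random diagonal per face" and "a fair centre site joined to the four corners" induce the
same law of black connectivity (`CentreDiagonalEquivalence`).  The crux is irrelevance on the LONG
window `[0, pIK]` through the frozen end; the pivot replaces it by irrelevance on the SHORT window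
`[pIK, ½]` (`Δp = 0.0359`; in the conditioning chart: `G_s`-site percolation conditioned on evenness
of a Bernoulli(`7 − 4√3 ≈ 0.0718`)-sparse independent face set) plus Beffara's mixed-percolation
interpolation `G_s`-site → bond-ℤ² (route UnionJackBeffara, item `MixedInterpolation`,
stmt-CriticalPhenomena-4559, SHARED).
-/

noncomputable section

namespace Summit.CriticalPhenomena.CardyFormulaZ2.Cruxes.CornerLineDescent.SparseParityPivot

open scoped BigOperators Topology Classical MeasureTheory ProbabilityTheory ENNReal NNReal
open Filter Set Function MeasureTheory
open Literature.Probability.Percolation (sitePercolation bondPercolation half BondConfig embDomainCrossing)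
open Literature.Probability.LatticeModels
open Literature.Probability.RandomPlanarGeometry
open Summit.CriticalPhenomena.CardyFormulaZ2.Theorems.CornerLineDescent.SymmetricSeed

/-! ## §1 The pivot model in the crux's gauge -/

/-- `G_s` black graph in the gauge: same colours `gaugeColour` (at density `p = ½` they are i.i.d.
fair), axis neighbours, plus BOTH diagonals of face `f` iff its centre site is open — the coin bit
`ω.2.2.2.2 ∋ f` re-read as a centre (an open centre is adjacent to its four corners, hence joins
every pair of black corners). [cite: Beffara2008Universal, §5.1] -/
def sgsEdges (ω : Bits) : BondConfig (Site 2) :=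
  {e | ∃ u v, e = s(u, v) ∧ gaugeColour ω u ∧ gaugeColour ω v ∧
    (v = u + ![1, 0] ∨ v = u + ![0, 1] ∨ (v = u + ![1, 1] ∧ u ∈ ω.2.2.2.2) ∨
      (v = u + ![1, -1] ∧ (u + ![0, -1]) ∈ ω.2.2.2.2))}

/-- Crude embedded crossing event of `R` at mesh `δ` for the `G_s` black graph (cells at
`v0 + i v1`, arcs `0 → 2`, exactly as `crossingEvent`). [folklore] -/
def sgsCrossingEvent (R : ConformalRectangle) (δ : ℝ) : Set Bits :=
  {ω | sgsEdges ω ∈ embDomainCrossing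
    (fun v : Site 2 => ((v 0 : ℝ) : ℂ) + ((v 1 : ℝ) : ℂ) * Complex.I) R.carrier δ (R.arc 0) (R.arc 2)}

/-- Crude crossing probability of site percolation on the centred square lattice (fair colours:
density `½` makes `gaugeColour` i.i.d. fair; fair centres). [cite: Beffara2008Universal, §5.1] -/
def sgsCrossingProb (R : ConformalRectangle) (δ : ℝ) : ℝ :=
  (gaugeMeasure (1 / 2)).real (sgsCrossingEvent R δ)

/-- **CentreDiagonalEquivalence** (provable now, size M): for every colouring, "one uniformly
random diagonal per face" (`gaugeEdges`, the corner line's saddle coin) and "fair centre site"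
(`sgsEdges`) give the same law of the black-connectivity relation — on a checkerboard face either
joins the black diagonal pair with probability `½`, on every other face neither changes black
connectivity — face by face independently; hence equal crude crossing probabilities at `p = ½`
(and in fact at every `p`).  Exact checks: `4×2`, `3×3`, `4×3` boxes, `t ∈ {1, ½, ¼, 0}`
(toy/check_identities.py: 231/1024, 1/2, 49293/131072; 2/9, 9/40, 31/128 — identical). [folklore] -/
def CentreDiagonalEquivalence : Prop :=
  ∀ (R : ConformalRectangle) (δ : ℝ), sgsCrossingProb R δ = gaugeCrossingProb (1 / 2) R δ

/-! ## §2 The transfer -/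

/-- **UpperWindowIrrelevance** (= SparseParityBridge; the crux's PRIVATE content after the pivot):
corner irrelevance on the short window `p ∈ [pIK, ½]` only — the crude crossing probabilities of
the isotropic IK gauge and of `G_s`-site percolation differ by `o(1)` in every conformal rectangle.
[folklore] -/
def UpperWindowIrrelevance : Prop :=
  ∀ R : ConformalRectangle,
    Tendsto (fun δ : ℝ => gaugeCrossingProb pIK R δ - gaugeCrossingProb (1 / 2) R δ) (𝓝[>] 0) (𝓝 0)

/-- Cardy for site percolation on the centred square lattice (cell gauge, crude event) — the
anchor `UnionJackCardy` of route UnionJackBeffara (stmt-CriticalPhenomena-4557, first conjunct) up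
to `CentreDiagonalEquivalence` and a boundary typing bridge; under `CardyIK` it is EQUIVALENT to
`UpperWindowIrrelevance`. [cite: Beffara2008Universal, §5.1] -/
def CardySGs : Prop :=
  ∀ R : ConformalRectangle, R.HasCrossingLimit (gaugeCrossingProb (1 / 2) R) cardyFunction

/-- **SGsDescent** (the SHARED leg): Cardy for `G_s`-site percolation implies crude Cardy for
bond-ℤ² on the standard embedding.  Intended proof: `CentreDiagonalEquivalence` + TypingBridge₁
(cell-gauge crude event ↔ UnionJackBeffara's `MixedSite` crude event `P half`) +
`UnionJackBeffara.MixedInterpolation` (stmt-CriticalPhenomena-4559 = Beffara 2008 §5.2 eq.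
(interpolation), XL, wanted by the sub independently of IK) + TypingBridge₂ (`P 0` on `δG_s` =
bond-ℤ² at `½` on the integer lattice of odd face centres ↔ `bondStdCrossingProb`).
[cite: Beffara2008Universal, §5.2] -/
def SGsDescent : Prop :=
  CardySGs → ∀ R : ConformalRectangle, R.HasCrossingLimit (bondStdCrossingProb R) cardyFunction

/-- Limits transfer along a vanishing difference on the short window. [folklore] -/
theorem cardySGs_of_upperWindow
    (hIK : ∀ R : ConformalRectangle, R.HasCrossingLimit (gaugeCrossingProb pIK R) cardyFunction)
    (hw : UpperWindowIrrelevance) : CardySGs := by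
  intro R φ x hφx
  have h3 := (hIK R φ x hφx).sub (hw R)
  simp only [sub_sub_cancel, sub_zero] at h3
  exact h3

/-- **Composition concluding the crux BY NAME** (`Iff.rfl` through the lead's
`cornerLineDescent_iff`): short-window irrelevance + the shared `G_s → bond` descent. [folklore] -/
theorem cornerLineDescent_of (hw : UpperWindowIrrelevance) (hdesc : SGsDescent) :
    Summit.CriticalPhenomena.CardyFormulaZ2.Theses.CardyIKTransport.CornerLineDescent := by
  rw [cornerLineDescent_iff]
  intro hIK
  exact hdesc (cardySGs_of_upperWindow hIK hw)

/-! ## §3 First lemma: the exact sparse-conditioning (parity-mixture) identity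

Over the tree's free corner-fugacity box law `cornerGibbsMeasure t (innerVertices Λ) Λ ξ`
(weight `t ^ #odd inner faces`): it is the Bernoulli(`ρ`)-mixture, `ρ = (1 − t)/(1 + t)`, of the
UNIFORM colourings with NO odd face in `S` — which is literally `cornerGibbsMeasure 0 S Λ ξ`
(weight `0 ^ #odd faces in S`).  `ρ(√3/2) = 7 − 4√3 ≈ 0.0718`; `ρ(0) = 1` (the plaid), `ρ(1) = 0`.
Provable now (finite GF(2) algebra: `∏_f (t + (1−t)·[f even])` expanded over subsets; the evenness
constraints of any finite set of unit faces are linearly independent, so each conditioned class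
has `2 ^ (#Λ − #S)` fillings).  Exact check `3×3`, `t ∈ {½, ¼, ¾, 0, 1}`: deviation 0. -/

/-- The sparse-conditioning parameter `ρ(t) = (1 − t)/(1 + t)` (an involution of `[0,1]`). [folklore] -/
def sparseParam (t : ℝ) : ℝ := (1 - t) / (1 + t)

/-- **ParityMixtureIdentity** (first lemma; exact; provable now). [folklore] -/
def ParityMixtureIdentity : Prop :=
  ∀ (t : ℝ≥0), 0 < t → t ≤ 1 →
    ∀ (Λ : Finset (Site 2)) (ξ : Site 2 → Bool) (A : Set (Site 2 → Bool)),
      cornerGibbsMeasure t (innerVertices Λ) Λ ξ A =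
        ∑ S ∈ (innerVertices Λ).powerset,
          ENNReal.ofReal (sparseParam t ^ S.card *
              (1 - sparseParam t) ^ ((innerVertices Λ).card - S.card)) *
            cornerGibbsMeasure 0 S Λ ξ A

/-- `ρ(√3/2) = 7 − 4√3`. [folklore] -/
theorem sparseParam_ik : sparseParam (Real.sqrt 3 / 2) = 7 - 4 * Real.sqrt 3 := by
  have h3 : Real.sqrt 3 * Real.sqrt 3 = 3 := Real.mul_self_sqrt (by norm_num)
  have hpos : (0:ℝ) < 1 + Real.sqrt 3 / 2 := by positivity
  rw [sparseParam, div_eq_iff hpos.ne']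
  nlinarith [h3]

/-- The window is short: `½ − pIK = (7 − 4√3)/2 < 0.036`. [folklore] -/
theorem half_sub_pIK : (1 / 2 : ℝ) - pIK = (7 - 4 * Real.sqrt 3) / 2 := by
  unfold pIK; ring

/-! ## §4 The load-bearing stub, typed: SIGNED parity response on the short window

`S(p; R, δ) := Σ_f I_f(p)` with the lead's signed influence `influence p R δ f` (`= Cov_p(1_A, κ_f)/
(p(1−p))`, law-local by `Negative.QuadrantFlipLocal`); `d/dp gaugeCrossingProb p R δ = S(p; R, δ)`
is the landed Russo identity (p82972).  At `p = ½` the model is the FKG, colour-switching,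
D₄-symmetric product measure of `G_s`-site percolation (RSW = Köhler-Schindler–Tassion 2023 Thm 1).
Only finitely many faces have nonzero influence (`CrossingEventLocalAt`, landed), so the `tsum`
is a finite sum. -/

/-- Signed influence sum `Σ_f I_f(p)`. [folklore] -/
def signedInfluenceSum (p : ℝ) (R : ConformalRectangle) (δ : ℝ) : ℝ :=
  ∑' f : Site 2, influence p R δ f

/-- **SignedParityResponseSGs** (rate stub at the pivot, order 1 of the tilt expansion): the
signed single-face parity response of `G_s`-site percolation vanishes in the limit. [folklore] -/
def SignedParityResponseSGs : Prop :=
  ∀ R : ConformalRectangle, Tendsto (signedInfluenceSum (1 / 2) R) (𝓝[>] 0) (𝓝 0)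

/-- **UpperWindowSignedResponse** (the honest uniform version on the short window
`p ∈ [pIK, ½]`, i.e. corner fugacity `t ∈ [√3/2, 1]`, Dobrushin-unique weak tilts of `G_s`). [folklore] -/
def UpperWindowSignedResponse : Prop :=
  ∀ R : ConformalRectangle, ∀ ε : ℝ, 0 < ε →
    ∀ᶠ δ in 𝓝[>] (0:ℝ), ∀ p ∈ Set.Icc pIK (1 / 2), |signedInfluenceSum p R δ| ≤ ε

/-- **SignedRussoWindow** (provable now from the landed Russo identity + the mean value theorem:
the SIGNED derivative controls the increment). [folklore] -/
def SignedRussoWindow : Prop :=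
  ∀ (R : ConformalRectangle) (δ : ℝ), 0 < δ → ∀ M : ℝ,
    (∀ p ∈ Set.Icc pIK (1 / 2), |signedInfluenceSum p R δ| ≤ M) →
      |gaugeCrossingProb (1 / 2) R δ - gaugeCrossingProb pIK R δ| ≤ M * (1 / 2 - pIK)

/-- Elementary assembly of the private leg: uniform signed response on the short window ⇒
`UpperWindowIrrelevance`. [folklore] -/
theorem upperWindowIrrelevance_of (hR : SignedRussoWindow) (hS : UpperWindowSignedResponse) :
    UpperWindowIrrelevance := by
  intro R
  rw [Metric.tendsto_nhds]
  intro ε hε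
  have hwin : 0 < (1 / 2 : ℝ) - pIK := by
    rw [half_sub_pIK]
    have h : Real.sqrt 3 < 7 / 4 := by
      rw [Real.sqrt_lt' (by norm_num)]; norm_num
    linarith
  have hε' : 0 < ε / 2 / (1 / 2 - pIK) := by positivity
  filter_upwards [hS R _ hε', self_mem_nhdsWithin] with δ hδ hδpos
  have hb := hR R δ hδpos _ hδ
  rw [Real.dist_eq, sub_zero, abs_sub_comm]
  calc |gaugeCrossingProb (1 / 2) R δ - gaugeCrossingProb pIK R δ|
      ≤ ε / 2 / (1 / 2 - pIK) * (1 / 2 - pIK) := hb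
    _ = ε / 2 := div_mul_cancel₀ (ε / 2) hwin.ne'
    _ < ε := by linarith

end Summit.CriticalPhenomena.CardyFormulaZ2.Cruxes.CornerLineDescent.SparseParityPivot

end
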